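import Summits.KontsevichZagierPeriods.KontsevichZagierPeriods.Theses.SymplecticScissors

/-!
# Sketch for crux idea `real-subgroup-disc` (crux stmt-KontsevichZagierPeriods-4990, `PlanarAreas`)

Ideator 1, round 1 (planner-cruxidea-stmt-KontsevichZagierPeriods-4990-1-0), 2026-08-16.

The line: equal planar areas ⇒ (MERGE) one interval representation `[(0,1), g]` of value `0` with
`g` continuous `ℚ`-semialgebraic on `[0,1]` ⇒ (LOOP, the transcendence input: Wüstholz's analytic
subgroup theorem in the exact-sequence form HW2022 Thm 6.2 for the product of Rosenlicht generalised
Jacobians, its UNIQUENESS giving a conjugation-stable = REAL obstruction, transported) a real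
semialgebraic null-homotopic loop `ℓ` in an open semialgebraic `U ⊆ ℝᴺ` carrying a closed
semialgebraic `C¹` 1-form `Σ aⱼ dxⱼ` with `ℓ^*(Σ aⱼ dxⱼ) = g dt` ⇒ (DISC, semialgebraic topology)
an exact square `A dt + B ds` on `[0,1]²` with bottom edge `g` and null top/left/right edges ⇒
(GREEN, rule 3 twice + the coordinate swap + 1a/1b bookkeeping) `[(0,1), g] ∈ KZ.relations`.

Everything is stated over existing declarations; nothing is proved except the composition.
-/

noncomputable section

set_option linter.dupNamespace false

open Set MeasureTheory
open Literature.NumberTheory.Transcendental Literature.ModelTheory.ExponentialFields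

namespace Summit.KontsevichZagierPeriods.KontsevichZagierPeriods.Cruxes.PlanarAreas.Sketch

open Summit.KontsevichZagierPeriods.KontsevichZagierPeriods.Theses.SymplecticScissors (PlanarAreas)

/-- The closed unit square; coordinate `p 0 = t` (edge parameter), `p 1 = s` (homotopy parameter). -/
def closedSq : Set (Fin 2 → ℝ) := {p | 0 ≤ p 0 ∧ p 0 ≤ 1 ∧ 0 ≤ p 1 ∧ p 1 ≤ 1}

/-- The open unit square. -/
def openSq : Set (Fin 2 → ℝ) := {p | 0 < p 0 ∧ p 0 < 1 ∧ 0 < p 1 ∧ p 1 < 1}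

/-- The closed unit interval as a subset of `Fin 1 → ℝ`. -/
def closedSeg : Set (Fin 1 → ℝ) := {z | z 0 ∈ Icc (0 : ℝ) 1}

/-- The open unit interval as a subset of `Fin 1 → ℝ` (the domain of the merged representation). -/
def openSeg : Set (Fin 1 → ℝ) := {z | z 0 ∈ Ioo (0 : ℝ) 1}

/-- GREEN DATA on the unit square: a 1-form `A dt + B ds` with `ℚ`-semialgebraic coefficients,
continuous on the CLOSED square (closed-fibre continuity of rule 3 in both directions), which is
closed on the open square off finitely many vertical lines `t ∈ E` (the junctions of the merged
arcs): there `∂ₛA = ∂ₜB = D` with `D` absolutely integrable — `[openSq, D]` is the one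
two-dimensional representation of the chain, read once as `∂ₛA` and once as `∂ₜB`. -/
structure SquareGreenData (A B D : (Fin 2 → ℝ) → ℝ) : Prop where
  semialgA : IsSemialgebraicFunOn ℚ closedSq A
  semialgB : IsSemialgebraicFunOn ℚ closedSq B
  semialgD : IsSemialgebraicFunOn ℚ openSq D
  contA : ContinuousOn A closedSq
  contB : ContinuousOn B closedSq
  integrableD : IntegrableOn D openSq volume
  closed_off_finite : ∃ E : Finset ℝ, ∀ p ∈ openSq, p 0 ∉ E →
      HasDerivAt (fun s : ℝ => A ![p 0, s]) (D p) (p 1) ∧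
      HasDerivAt (fun t : ℝ => B ![t, p 1]) (D p) (p 0)

/-- An EXACT SQUARE CERTIFICATE for `g : ℝ → ℝ`: Green data whose bottom edge is `g` and whose
top, left and right edges are null. (Shape of `K^*Ω_Q` for a semialgebraic null-homotopy `K` of
the real loop `π ∘ δ` in the quotient group `Q(ℝ)⁰`, the vertical sides being the constant loop.) -/
def HasExactSquare (g : ℝ → ℝ) : Prop :=
  ∃ A B D : (Fin 2 → ℝ) → ℝ, SquareGreenData A B D ∧
    (∀ t ∈ Icc (0 : ℝ) 1, A ![t, 1] = 0) ∧ (∀ s ∈ Icc (0 : ℝ) 1, B ![0, s] = 0) ∧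
    (∀ s ∈ Icc (0 : ℝ) 1, B ![1, s] = 0) ∧ ∀ t ∈ Icc (0 : ℝ) 1, A ![t, 0] = g t

/-- FIRST LEMMA (the engine, provable now; size M–L): **Green with three null edges is a KZ chain.**
If `A dt + B ds` is Green data on the square with null top/left/right edges, the bottom-edge
representation `[(0,1), A(·,0)]` is a relation. Proof plan: cut the square at the lines `t ∈ E`
(1a); on each strip rule 3 along `s` with primitive `A` gives `[strip, D] − [(tₖ,tₖ₊₁), A(·,1) − A(·,0)]`,
the swap `(t,s) ↦ (s,t)` (rule 2, `KZ.permRel ⊆ changeOfVariablesRel`) and rule 3 along `t` with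
primitive `B` give `[strip, D] − [(0,1)ₛ, B(tₖ₊₁,·) − B(tₖ,·)]`; the `s`-representations telescope by
1b to `[(0,1)ₛ, B(1,·) − B(0,·)] = [(0,1)ₛ, 0] ∈ relations` (`KZ.of_mem_levelRel_of_eqOn_zero`), the
`t`-representations reassemble by 1a to `[(0,1), −A(·,0)]`, whence `[(0,1), A(·,0)] ∈ relations`. -/
def GreenSquareNullEdges : Prop :=
  ∀ (A B D : (Fin 2 → ℝ) → ℝ) (r : KZ.IntegralRep 1), SquareGreenData A B D →
    (∀ t ∈ Icc (0 : ℝ) 1, A ![t, 1] = 0) → (∀ s ∈ Icc (0 : ℝ) 1, B ![0, s] = 0) →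
    (∀ s ∈ Icc (0 : ℝ) 1, B ![1, s] = 0) →
    r.domain = openSeg → (∀ z ∈ r.domain, r.integrand z = A ![z 0, 0]) →
    KZ.of r ∈ KZ.relations

/-- A REAL NULL-HOMOTOPIC LOOP CERTIFICATE for `g`: an open `ℚ`-semialgebraic `U ⊆ ℝᴺ` (a Nash
tubular neighbourhood of the real Lie group `Q(ℝ)⁰`), a CLOSED 1-form `Σ aⱼ dxⱼ` with
`ℚ`-semialgebraic `C¹` coefficients on `U` (the retraction pull-back of the invariant form `Ω_Q`),
a `ℚ`-semialgebraic `C¹` loop `ℓ` in `U` (the image `π ∘ δ` of the merged arcs), null-homotopic in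
`U` through a CONTINUOUS homotopy of loops `H` (it lifts to a closed loop in the Lie algebra), whose
pull-back `ℓ^*(Σ aⱼ dxⱼ)` is `g dt`. No algebraic-group vocabulary is needed to STATE it. -/
def HasRealNullLoop (g : ℝ → ℝ) : Prop :=
  ∃ (N : ℕ) (U : Set (Fin N → ℝ)) (a : Fin N → (Fin N → ℝ) → ℝ) (ℓ : ℝ → (Fin N → ℝ))
    (H : (Fin 2 → ℝ) → (Fin N → ℝ)),
    IsOpen U ∧ IsSemialgebraic ℚ U ∧ (∀ j, IsSemialgebraicFunOn ℚ U (a j)) ∧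
    (∀ j, ContDiffOn ℝ 1 (a j) U) ∧
    (∀ x ∈ U, ∀ i j : Fin N,
      fderiv ℝ (a j) x (Pi.single i 1) = fderiv ℝ (a i) x (Pi.single j 1)) ∧
    IsSemialgebraicMapOn ℚ closedSeg (fun z => ℓ (z 0)) ∧ ContDiffOn ℝ 1 ℓ (Icc 0 1) ∧
    ℓ 0 = ℓ 1 ∧ (∀ t ∈ Icc (0 : ℝ) 1, ℓ t ∈ U) ∧
    ContinuousOn H closedSq ∧ MapsTo H closedSq U ∧
    (∀ t ∈ Icc (0 : ℝ) 1, H ![t, 0] = ℓ t) ∧ (∀ t ∈ Icc (0 : ℝ) 1, H ![t, 1] = ℓ 0) ∧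
    (∀ s ∈ Icc (0 : ℝ) 1, H ![0, s] = ℓ 0) ∧ (∀ s ∈ Icc (0 : ℝ) 1, H ![1, s] = ℓ 0) ∧
    ∀ t ∈ Ioo (0 : ℝ) 1, (∑ j, a j (ℓ t) * deriv (fun u => ℓ u j) t) = g t

/-- MERGE (size L, dimension ≤ 2, rules 1a/2/3/1b; no transcendence): two integrand-`1` planar
representations differ, modulo `KZ.relations`, by ONE interval representation `[(0,1), g]` with
`g` continuous `ℚ`-semialgebraic on `[0,1]` — open domains WLOG (Disproof §4), cylindrical
decomposition (1a), shear `y ↦ y − φ(x)` and compactification `(x,y) ↦ (1/x, yx²)` (rule 2,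
`|det| = 1`), rule 3 along `y` with primitive `F = y` (cell ↦ `[(a,b), h]`), Puiseux flattening
`x = a + u^q` (rule 2) making every arc end continuous, affine reparametrisation onto `(0,1)`
(rule 2) and summation over a common parameter (1b). -/
def MergeToInterval : Prop :=
  ∀ (r r' : KZ.IntegralRep 2), (∀ p ∈ r.domain, r.integrand p = 1) →
    (∀ p ∈ r'.domain, r'.integrand p = 1) →
    ∃ (g : ℝ → ℝ) (r₁ : KZ.IntegralRep 1), ContinuousOn g (Icc 0 1) ∧
      IsSemialgebraicFunOn ℚ closedSeg (fun z => g (z 0)) ∧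
      r₁.domain = openSeg ∧ (∀ z ∈ r₁.domain, r₁.integrand z = g (z 0)) ∧
      KZ.of r - KZ.of r' - KZ.of r₁ ∈ KZ.relations

/-- LOOP (the transported transcendence input, XL; HW2022 Thm 6.2 + Serre GACC V.10 Prop 5 +
V.19 Cor + uniqueness/complex conjugation + Delfs–Knebusch): every interval representation of
value `0` with integrand continuous `ℚ`-semialgebraic on `[0,1]` has a real null-homotopic loop
certificate. (The value hypothesis is the ONLY load-bearing hypothesis of the crux,
Disproof §2 `not_withoutValue`; here it is consumed exactly once, as `Ω(v) = 0`.) -/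
def IntervalKernelLoop : Prop :=
  ∀ (g : ℝ → ℝ) (r₁ : KZ.IntegralRep 1), ContinuousOn g (Icc 0 1) →
    IsSemialgebraicFunOn ℚ closedSeg (fun z => g (z 0)) →
    r₁.domain = openSeg → (∀ z ∈ r₁.domain, r₁.integrand z = g (z 0)) → r₁.value = 0 →
    HasRealNullLoop g

/-- DISC (semialgebraic topology, size L; Delfs–Knebusch / BCR triangulation + the tree's
`OhmotoShiota2017_c1Triangulation` for `C¹` cells, or Nash approximation): a real null-homotopic
loop certificate yields an exact square (`A dt + B ds = K^*(Σ aⱼ dxⱼ)` for a semialgebraic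
null-homotopy `K`, `C¹` on closed vertical strips). -/
def DiscToSquare : Prop :=
  ∀ g : ℝ → ℝ, HasRealNullLoop g → HasExactSquare g

/-- COMPOSITION (kernel-checked): MERGE ∧ LOOP ∧ DISC ∧ GREEN ⇒ the crux `PlanarAreas` BY NAME.
Soundness of the calculus (`KZ.relations_le_ker_eval_holds`, proved in tree) turns equal areas into
`r₁.value = 0`. -/
theorem planarAreas_of (hM : MergeToInterval) (hL : IntervalKernelLoop) (hD : DiscToSquare)
    (hG : GreenSquareNullEdges) : PlanarAreas := by
  intro r r' hr hr' hv
  obtain ⟨g, r₁, hg, hgs, hdom, hint, hrel⟩ := hM r r' hr hr'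
  -- soundness: the merged representation has value 0
  have hval : r₁.value = 0 := by
    have h0 := KZ.relations_le_ker_eval_holds hrel
    rw [AddMonoidHom.mem_ker, map_sub, map_sub, KZ.eval_of, KZ.eval_of, KZ.eval_of, hv,
      sub_self, zero_sub, neg_eq_zero] at h0
    exact h0
  obtain ⟨A, B, D, hABD, htop, hleft, hright, hbot⟩ := hD g (hL g r₁ hg hgs hdom hint hval)
  have hr₁ : KZ.of r₁ ∈ KZ.relations := by
    refine hG A B D r₁ hABD htop hleft hright hdom ?_
    intro z hz
    rw [hint z hz]
    have hz' : z 0 ∈ Ioo (0 : ℝ) 1 := by rw [hdom] at hz; exact hz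
    exact (hbot (z 0) (Ioo_subset_Icc_self hz')).symm
  have := KZ.relations.add_mem hrel hr₁
  simpa [KZ.Equivalent] using this

end Summit.KontsevichZagierPeriods.KontsevichZagierPeriods.Cruxes.PlanarAreas.Sketch

end
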